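import Summits.ResolutionOfSingularities.ResolutionOfSingularities.Theorems.PurelyInseparableDim4Spivakovsky
import Summits.ResolutionOfSingularities.ResolutionOfSingularities.Theorems.PurelyInseparableDim4SpineGame
import Literature.AlgebraicGeometry.Resolution.CentreBlowupOrdAlongBasics
import HarnessLib

/-!
# [OURS · res-dim4-pi PR-9c, annex] MODE S itself wins: Spivakovsky's rule `R_S`, read on supports, is a
  positional winning strategy of the spine game

Cell `res-dim4-pi` (D-0157 DOOR 2), seat `res-dim4-p-11` (PR-9c lead).  The capstone `PurelyInseparableDim4SpineTerminates`
(p-10, p651534) records the EXISTENCE of a positional winning strategy (`PurePositionalWin4 q ↔ 0 < q`).  The engines' spine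
mode of record is the RULE «MODE S = R_S» (desk WORD #22 (b) / #25 (b): Spivakovsky's strategy transcribed after
Bogner–Weinzierl §4.3).  This annex names that rule in the tree and proves that IT wins: `spineRuleS q A` = Spivakovsky's
`strat` [cite: Spivakovsky1983, §II] applied to the rational reading `{a/q : a ∈ A}` of the support `A`, and
`isPurePositionalWin_spineRuleS : 0 < q → IsPurePositionalWin q (spineRuleS q)` — permissible whenever A has not yet won,
and no infinite pure play follows it (directly from `Spivakovsky.no_strategy_play'`, no boundary lemma needed: the
termination theorem only uses `min |a| ≥ q`).  HONEST SCOPE: `spineRuleS` agrees with any implementation of R_S up to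
the choice of the minimal permissible `Γ_r` in the one-vertex case (the source's Remark 2: «several possible Γ»); here
that choice is `Spivakovsky.minPerm` (a least-cardinality permissible subset).

[OURS · counted 0 · AI work weaker than expert review] A statement about OUR frame's spine game; NOTHING here proves
resolution of singularities in dimension ≥ 4 / characteristic `p`. bears_on: LADDER-RESOLUTION:D157-DOOR2 (res-dim4-pi ·
PR-9c annex · MODE S). Supports stmt-ResolutionOfSingularities-16155 (helper).
-/

set_option linter.dupNamespace false -- mandated namespace of this single-conjunct summit

open Finset
open scoped BigOperators

namespace Summit.ResolutionOfSingularities.ResolutionOfSingularities.Theorems.PIDim4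

open Literature.AlgebraicGeometry.Resolution
open Literature.AlgebraicGeometry.Resolution.CentreBlowup

/-- The rational reading `a ↦ a/q` of a lattice point of the spine game. [cite: Spivakovsky1983, §I (rational points)] -/
noncomputable def spineScale (q : ℕ) (a : Fin 4 →₀ ℕ) : Fin 4 → ℚ := fun k => (a k : ℚ) / q

/-- **MODE S** — Spivakovsky's rule read on supports: the strategy `Spivakovsky.strat` of the rational position
`{a/q : a ∈ A}` on all four coordinates. [cite: Spivakovsky1983, §II (the winning strategy) and Remark 1] -/
noncomputable def spineRuleS (q : ℕ) : SpineStrategy :=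
  fun A => Spivakovsky.strat (Finset.univ : Finset (Fin 4)) (A.image (spineScale q))

namespace SpineRuleS

variable {q : ℕ}

/-- `Σ_{k∈Γ} a_k/q = (degIn Γ a)/q`. [folklore] -/
theorem sum_spineScale (a : Fin 4 →₀ ℕ) (Γ : Finset (Fin 4)) :
    ∑ k ∈ Γ, spineScale q a k = (degIn Γ a : ℚ) / q := by
  simp only [spineScale, degIn, Nat.cast_sum, Finset.sum_div]

/-- The rational reading of a non-empty position is good on `univ`. [folklore] -/
theorem good_image (A : SpinePos) (hA : A.Nonempty) :
    Spivakovsky.Good (Finset.univ : Finset (Fin 4)) (A.image (spineScale q)) := by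
  refine ⟨hA.image _, fun g hg k => ?_, fun g _ k hk => absurd (Finset.mem_univ k) hk⟩
  obtain ⟨a, _, rfl⟩ := Finset.mem_image.mp hg
  simp only [spineScale]
  positivity

/-- Its denominators are bounded by `q`. [folklore] -/
theorem den_image (hq : 0 < q) (A : SpinePos) : Spivakovsky.Den q (A.image (spineScale q)) := by
  intro g hg k
  obtain ⟨a, _, rfl⟩ := Finset.mem_image.mp hg
  refine ⟨a k, ?_⟩
  have hqq : (q : ℚ) ≠ 0 := by exact_mod_cast hq.ne'
  simp only [spineScale]
  field_simp
  push_cast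
  ring

/-- While A has not won, `d ≥ 1` for the rational reading. [folklore] -/
theorem one_le_dG_image (hq : 0 < q) {A : SpinePos} (hA : ¬ SpineWon q A) :
    1 ≤ Spivakovsky.dG (Finset.univ : Finset (Fin 4)) (A.image (spineScale q)) := by
  have hne : A.Nonempty := by
    rw [Finset.nonempty_iff_ne_empty]; exact fun h => hA (Or.inl h)
  apply Spivakovsky.le_dG _ (hne.image _)
  intro g hg
  obtain ⟨a, ha, rfl⟩ := Finset.mem_image.mp hg
  have hle : q ≤ a.degree := by
    by_contra hlt; push Not at hlt; exact hA (Or.inr ⟨a, ha, hlt⟩)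
  have hqq : (0 : ℚ) < q := by exact_mod_cast hq
  rw [sum_spineScale, degIn_univ, le_div_iff₀ hqq, one_mul]
  exact_mod_cast hle

/-- **MODE S is permissible** while A has not won. [cite: Spivakovsky1983, §III Corollary] -/
theorem spinePermissible_spineRuleS (hq : 0 < q) {A : SpinePos} (hA : ¬ SpineWon q A) :
    SpinePermissible q (spineRuleS q A) A := by
  have hne : A.Nonempty := by
    rw [Finset.nonempty_iff_ne_empty]; exact fun h => hA (Or.inl h)
  have hperm := Spivakovsky.perm_strat (good_image A hne) (one_le_dG_image hq hA)
  refine ⟨hperm.1, fun a ha => ?_⟩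
  have h1 := hperm.2 _ (Finset.mem_image_of_mem (spineScale q) ha)
  have hqq : (0 : ℚ) < q := by exact_mod_cast hq
  rw [show Spivakovsky.strat univ (A.image (spineScale q)) = spineRuleS q A from rfl, sum_spineScale,
    le_div_iff₀ hqq, one_mul] at h1
  exact_mod_cast h1

/-- The chart law read rationally is Spivakovsky's move: `(chartExponent q Γ j a)/q = σ_{Γ,j}(a/q)` when
`q ≤ degIn Γ a`. [cite: Spivakovsky1983, §I (the transformation σ_{Γ,i})] -/
theorem spineScale_chartExponent (hq : 0 < q) {Γ : Finset (Fin 4)} {j : Fin 4} {a : Fin 4 →₀ ℕ}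
    (ha : q ≤ degIn Γ a) :
    spineScale q (chartExponent q Γ j a) = Spivakovsky.move Γ j (spineScale q a) := by
  have hqq : (q : ℚ) ≠ 0 := by exact_mod_cast hq.ne'
  funext k
  by_cases hk : k = j
  · subst hk
    rw [Spivakovsky.move_apply_self, sum_spineScale, spineScale, chartExponent_apply_self, Nat.cast_sub ha,
      sub_div, div_self hqq]
  · rw [Spivakovsky.move_apply_of_ne _ hk, spineScale, spineScale, chartExponent_apply_of_ne q _ hk]

/-- A pure move along a permissible `Γ` is the rational move on the reading. [folklore] -/
theorem image_pureMove (hq : 0 < q) {Γ : Finset (Fin 4)} {j : Fin 4} {A : SpinePos}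
    (hΓ : SpinePermissible q Γ A) :
    (pureMove q Γ j A).image (spineScale q) = (A.image (spineScale q)).image (Spivakovsky.move Γ j) := by
  rw [pureMove, Finset.image_image, Finset.image_image]
  exact Finset.image_congr fun a ha => by
    simp only [Function.comp_apply]
    exact spineScale_chartExponent hq (hΓ.2 a ha)

/-- **MODE S WINS THE SPINE GAME**: for `0 < q`, Spivakovsky's rule read on supports is a positional winning
strategy of Hironaka's constrained polyhedra game in four variables (strict threshold): permissible while A has not
won, and followed by NO infinite pure play. [cite: Spivakovsky1983, Theorem p. 421 and §§II–III] -/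
theorem isPurePositionalWin_spineRuleS (hq : 0 < q) : IsPurePositionalWin q (spineRuleS q) := by
  refine ⟨fun A hA => spinePermissible_spineRuleS hq hA, ?_⟩
  rintro ⟨A, hplay⟩
  have hW : ∀ l, ¬ SpineWon q (A l) := fun l => (hplay l).1
  have hne : ∀ l, (A l).Nonempty := fun l => by
    rw [Finset.nonempty_iff_ne_empty]; exact fun h => hW l (Or.inl h)
  choose ι hιmem hιstep using fun l => (hplay l).2
  refine Spivakovsky.no_strategy_play' (Finset.univ : Finset (Fin 4)) hq (fun l => (A l).image (spineScale q)) ι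
    (fun l => good_image (A l) (hne l)) (fun l => den_image hq (A l)) (fun l => one_le_dG_image hq (hW l))
    (fun l => hιmem l) (fun l => ?_)
  show (A (l + 1)).image (spineScale q) = ((A l).image (spineScale q)).image (Spivakovsky.move (spineRuleS q (A l)) (ι l))
  rw [hιstep l]
  exact image_pureMove hq (spinePermissible_spineRuleS hq (hW l))

/-- Hence (once more, by the named rule) the pure game is won positionally for every `0 < q`.
[cite: Spivakovsky1983, Theorem p. 421] -/
theorem purePositionalWin4_of_spineRuleS (hq : 0 < q) : PurePositionalWin4 q :=
  ⟨spineRuleS q, isPurePositionalWin_spineRuleS hq⟩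

end SpineRuleS

end Summit.ResolutionOfSingularities.ResolutionOfSingularities.Theorems.PIDim4
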